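import Summits.CriticalPhenomena.Ising3DConformalLimit.Theorems.LinkingParityCirclesSpinRatioMoebiusStubScalingLimitOfRatioLimit
import Summits.CriticalPhenomena.Ising3DConformalLimit.Theorems.LinkingParityCirclesSpinRatioMoebiusTwoPointPrelim
import Summits.CriticalPhenomena.Ising3DConformalLimit.Theorems.MoebiusLimitExists.Negative.MeshContinuity
import HarnessLib

/-!
# Crux `LinkingParityCircles.SpinRatioMoebius` (stmt-CriticalPhenomena-4530), line `registered` —
# stub `stub_ratioLimitOfScalingLimit`: the RATIO LIMITS from any non-degenerate pointwise scaling limit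

If the critical `ℤ³` Ising correlators `⟨∏σ_{[xᵢ/δ]}⟩_{β_c}` have a pointwise scaling limit `S` under some
renormalisation `ρ` (positive on `(0,1]`) with `S₂ > 0` off the diagonal, then at every level `m + m` the
weight-free spin pairing ratios `Q^δ_m(x) = ⟨∏σ_{[xᵢ/δ]}⟩ / ∏_j ⟨σ_{[x_j/δ]}σ_{[x_{m+j}/δ]}⟩` converge locally
uniformly on the non-coincident locus to the pairing quotient `S_{2m}(x) / ∏_j S_2(x_j, x_{m+j})`.

Proof: the numerator `ρ^{2m}⟨∏σ⟩ → S_{2m}` (the scaling limit at level `m + m`); each rescaled pair factor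
`ρ² ⟨σ_{[x_j/δ]}σ_{[x_{m+j}/δ]}⟩ → S_2(x_j, x_{m+j})` (the level-`2` limit composed with the pair projection), hence
their product converges (`tendstoLocallyUniformlyOn_finsetProd`, the limits being continuous on the locus by the mesh
continuity of every pointwise limit, `LimitMeshContinuity.continuousOn_limit`); the quotient converges by
`TendstoLocallyUniformlyOn.div₀` (the limit denominator is `> 0`); and for `δ ∈ (0,1]` the quotient IS `Q^δ_m`
by the exact factorisation `ρ^{2m}⟨∏σ⟩ = Q^δ_m · ∏_j ρ²⟨σσ⟩` (`rescaled_even_factorisation`, `ρ δ ≠ 0`, `⟨σσ⟩ > 0`).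

References: S. Friedli, Y. Velenik (CUP 2017) Thm. 3.17; H. Duminil-Copin (2019) Thm. 4.8.
-/

noncomputable section

namespace Summit.CriticalPhenomena.Ising3DConformalLimit.Cruxes.SpinRatioMoebius.Birth

open Literature.Probability.LatticeModels Filter Set Metric
open Summit.CriticalPhenomena.Ising3DConformalLimit.Cruxes.IsingEuclidUpgradeR4NonGaussian.FreeCovarianceDeltaDichotomy
  (criticalCorr_two_pos')
open scoped Topology

/-! ## §A The rescaled pair factors of a pointwise scaling limit -/

/-- Each rescaled two-point factor `ρ² ⟨σ_{[x_j/δ]}σ_{[x_{m+j}/δ]}⟩` of a pointwise scaling limit `S` converges to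
`S_2(x_j, x_{m+j})` locally uniformly on the locus. [folklore] -/
theorem tendsto_pairFactor_of_scalingLimit {ρ : ℝ → ℝ} {S : CorrFamily 3}
    (hlim : HasPointwiseScalingLimit (criticalCorr 3) ρ S) (m : ℕ) (j : Fin m) :
    TendstoLocallyUniformlyOn
      (fun (δ : ℝ) (x : Fin (m + m) → EuclideanSpace ℝ (Fin 3)) =>
        ρ δ ^ 2 * criticalCorr 3 2 ![latticeApprox δ (x (Fin.castAdd m j)), latticeApprox δ (x (Fin.natAdd m j))])
      (fun x => S 2 ![x (Fin.castAdd m j), x (Fin.natAdd m j)]) (𝓝[>] (0:ℝ)) (NonCoincident 3 (m + m)) := by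
  have h := (hlim 2).comp _ (pairProj_mapsTo m j) (continuous_pairProj m j).continuousOn
  refine h.congr fun δ x _ => ?_
  simp only [Function.comp_apply, rescaledCorrelator_apply]
  have hcfg : (fun i => latticeApprox δ ((![x (Fin.castAdd m j), x (Fin.natAdd m j)] :
      Fin 2 → EuclideanSpace ℝ (Fin 3)) i)) =
      ![latticeApprox δ (x (Fin.castAdd m j)), latticeApprox δ (x (Fin.natAdd m j))] := by
    funext i; fin_cases i <;> rfl
  rw [hcfg]

/-- The limit pair factor `x ↦ S_2(x_j, x_{m+j})` of a pointwise scaling limit of the critical `ℤ³` correlators is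
continuous on the locus (mesh continuity of `S_2` composed with the pair projection). [folklore] -/
theorem continuousOn_pairLimit_of_scalingLimit {ρ : ℝ → ℝ} {S : CorrFamily 3}
    (hlim : HasPointwiseScalingLimit (criticalCorr 3) ρ S) (m : ℕ) (j : Fin m) :
    ContinuousOn (fun x : Fin (m + m) → EuclideanSpace ℝ (Fin 3) => S 2 ![x (Fin.castAdd m j), x (Fin.natAdd m j)])
      (NonCoincident 3 (m + m)) :=
  (Summit.CriticalPhenomena.Ising3DConformalLimit.LimitMeshContinuity.continuousOn_limit hlim 2).comp
    (continuous_pairProj m j).continuousOn (pairProj_mapsTo m j)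

/-- The product of the rescaled pair factors converges to the product of the limit pair factors, locally uniformly
on the locus. [folklore] -/
theorem tendsto_prodPairFactor_of_scalingLimit {ρ : ℝ → ℝ} {S : CorrFamily 3}
    (hlim : HasPointwiseScalingLimit (criticalCorr 3) ρ S) (m : ℕ) :
    TendstoLocallyUniformlyOn
      (fun (δ : ℝ) (x : Fin (m + m) → EuclideanSpace ℝ (Fin 3)) =>
        ∏ j : Fin m, (ρ δ ^ 2 *
          criticalCorr 3 2 ![latticeApprox δ (x (Fin.castAdd m j)), latticeApprox δ (x (Fin.natAdd m j))]))
      (fun x => ∏ j : Fin m, S 2 ![x (Fin.castAdd m j), x (Fin.natAdd m j)]) (𝓝[>] (0:ℝ))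
      (NonCoincident 3 (m + m)) :=
  tendstoLocallyUniformlyOn_finsetProd (Finset.univ : Finset (Fin m))
    (fun j _ => tendsto_pairFactor_of_scalingLimit hlim m j)
    (fun j _ => continuousOn_pairLimit_of_scalingLimit hlim m j)

/-! ## §B The stub -/

/-- **Stub `stub_ratioLimitOfScalingLimit` (ratio limits from ANY non-degenerate pointwise scaling limit).**
[folklore] -/
theorem stub_ratioLimitOfScalingLimit :
    ∀ (ρ : ℝ → ℝ) (S : Literature.Probability.LatticeModels.CorrFamily 3), (∀ δ ∈ Set.Ioc (0:ℝ) 1, 0 < ρ δ) → Literature.Probability.LatticeModels.HasPointwiseScalingLimit (Literature.Probability.LatticeModels.criticalCorr 3) ρ S → Literature.Probability.LatticeModels.IsNondegenerateTwoPoint S → ∀ m : ℕ, TendstoLocallyUniformlyOn (fun (δ : ℝ) (x : Fin (m + m) → EuclideanSpace ℝ (Fin 3)) => Literature.Probability.LatticeModels.criticalCorr 3 (m + m) (fun i => Literature.Probability.LatticeModels.latticeApprox δ (x i)) / ∏ j : Fin m, Literature.Probability.LatticeModels.criticalCorr 3 2 ![Literature.Probability.LatticeModels.latticeApprox δ (x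 (Fin.castAdd m j)), Literature.Probability.LatticeModels.latticeApprox δ (x (Fin.natAdd m j))]) (fun x => S (m + m) x / ∏ j : Fin m, S 2 ![x (Fin.castAdd m j), x (Fin.natAdd m j)]) (nhdsWithin 0 (Set.Ioi 0)) (Literature.Probability.LatticeModels.NonCoincident 3 (m + m)) := by
  intro ρ S hρ hlim hnd m
  classical
  -- continuity and non-vanishing of the limits on the locus
  have hcS : ContinuousOn (S (m + m)) (NonCoincident 3 (m + m)) :=
    Summit.CriticalPhenomena.Ising3DConformalLimit.LimitMeshContinuity.continuousOn_limit hlim (m + m)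
  have hcP : ContinuousOn (fun x : Fin (m + m) → EuclideanSpace ℝ (Fin 3) =>
      ∏ j : Fin m, S 2 ![x (Fin.castAdd m j), x (Fin.natAdd m j)]) (NonCoincident 3 (m + m)) :=
    continuousOn_finsetProd _ fun j _ => continuousOn_pairLimit_of_scalingLimit hlim m j
  have hP0 : ∀ x ∈ NonCoincident 3 (m + m),
      (∏ j : Fin m, S 2 ![x (Fin.castAdd m j), x (Fin.natAdd m j)]) ≠ 0 :=
    fun x hx => Finset.prod_ne_zero_iff.2 fun j _ => (hnd _ (pairProj_mapsTo m j hx)).ne'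
  -- the quotient of the rescaled correlator by the product of the rescaled pair factors converges
  have hdiv := (hlim (m + m)).div₀ (tendsto_prodPairFactor_of_scalingLimit hlim m) hcS hcP hP0
  -- and for `δ ∈ (0, 1]` that quotient is exactly the pairing ratio
  refine TendstoLocallyUniformlyOn.congr_eventually hdiv ?_
  filter_upwards [Ioc_mem_nhdsGT (zero_lt_one' ℝ)] with δ hδ x _
  have hQ : (∏ j : Fin m, (ρ δ ^ 2 *
      criticalCorr 3 2 ![latticeApprox δ (x (Fin.castAdd m j)), latticeApprox δ (x (Fin.natAdd m j))])) ≠ 0 :=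
    Finset.prod_ne_zero_iff.2 fun j _ =>
      mul_ne_zero (pow_ne_zero 2 (hρ δ hδ).ne') (criticalCorr_two_pos' _ _).ne'
  simp only [Pi.div_apply]
  rw [rescaled_even_factorisation ρ m δ x, mul_div_assoc, div_self hQ, mul_one]

end Summit.CriticalPhenomena.Ising3DConformalLimit.Cruxes.SpinRatioMoebius.Birth

end
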